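import Summits.QuantumFields.YangMills.Theorems.ConvexGribovBodyNonSimplyConnectedLatticeGapWeakMixingFunnel
import Literature.MathematicalPhysics.QuantumLattice.LatticeGaugeDLRProofs
import Literature.Probability.LatticeModels.GibbsSpecificationDLRProofs
import HarnessLib

/-!
# DLR states of the lattice Yang–Mills specification are gauge invariant (Elitzur in DLR form)
# (stub `stub_dlr_gaugeInvariant` (EZ1) of crux stmt-QuantumFields-16405, route `ConvexGribovBody`, line `Sketch` v7)

For the Wilson specification `γ = ymSpecification ρ β` on `ℤ^d` (compact second-countable gauge group `G`,
continuous representation `ρ`, any real `β`), every DLR state `μ ∈ 𝒢(γ)` is invariant under every gauge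
transformation `U ↦ U^g`, `U^g(x,i) = g(x) U(x,i) g(x+eᵢ)⁻¹`, `g : ℤ^d → G` arbitrary (not necessarily of
finite support): `μ ∘ (U ↦ U^g)⁻¹ = μ`.

Proof.
1. *Finitely supported `g`.* If `g = 1` at both endpoints of every link outside a finite link set `Λ`, then
   `U^g = U` off `Λ`, so the kernel `γ_Λ(· | η)` — which depends on the exterior datum `η` only through
   `η|_{Λᶜ}` (`ymSpecification_congr_exterior`) — satisfies `γ_Λ(· | η^g) = γ_Λ(· | η)`, and gauge
   covariance of the kernels (`ymSpecification_map_gaugeTransformZd_holds`, Literature) gives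
   `γ_Λ(T_g⁻¹ A | η) = γ_Λ(A | η)`. Two applications of the DLR equation `μ(A) = ∫ γ_Λ(A | η) dμ(η)` then
   give `μ(T_g⁻¹ A) = μ(A)` (`map_gaugeTransformZd_eq_of_eq_one_off`).
2. *General `g`.* Both `μ ∘ T_g⁻¹` and `μ` are probability measures, so it suffices to compare them on the
   π-system of measurable cylinder sets, which generates the product σ-algebra (Mathlib
   `generateFrom_measurableCylinders`, `ext_of_generate_finite`). A cylinder set `A` over the finite link
   set `s` satisfies `T_g⁻¹ A = T_{g'}⁻¹ A` for the truncation `g'` of `g` to the endpoints of `s` (`g' = 1`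
   elsewhere), because `(U^g)(e)` involves `g` only at the two endpoints of `e` (`exists_gauge_truncation`);
   and `g'` is finitely supported, so step 1 applies.

References: S. Elitzur, Phys. Rev. D 12 (1975) 3978; E. Seiler, LNP 159 (1982), Ch. 2; H.-O. Georgii,
*Gibbs Measures and Phase Transitions* (2011), Def. 1.23 and §5.1 (symmetries of specifications).
-/

set_option autoImplicit false

noncomputable section

open MeasureTheory
open Literature.Probability.LatticeModels
open Literature.MathematicalPhysics.QuantumLattice

namespace Summit.QuantumFields.YangMills.Theorems.NonSimplyConnectedLatticeGap

section GaugeGeometry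

variable {d : ℕ} {G : Type*} [Group G]

/-- A gauge transformation that is trivial at both endpoints of the link `e` does not move the link variable
`U e`. -/
theorem gaugeTransformZd_apply_of_eq_one {g : Site d → G} (U : LGConfig d G) {e : ZdEdge d}
    (h1 : g e.1 = 1) (h2 : g (e.1 + Pi.single e.2 1) = 1) : gaugeTransformZd g U e = U e := by
  simp [gaugeTransformZd, h1, h2]

/-- The links with an endpoint in a finite set of sites form (a subset of) a finite set of links. -/
theorem exists_finset_links_touching (B : Finset (Site d)) :
    ∃ Λ : Finset (ZdEdge d), ∀ e : ZdEdge d, (e.1 ∈ B ∨ e.1 + Pi.single e.2 1 ∈ B) → e ∈ Λ := by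
  classical
  refine ⟨B ×ˢ (Finset.univ : Finset (Fin d)) ∪ (B ×ˢ (Finset.univ : Finset (Fin d))).image
    (fun p => (p.1 - Pi.single p.2 1, p.2)), fun e he => ?_⟩
  rcases he with h | h
  · exact Finset.mem_union_left _ (Finset.mem_product.2 ⟨h, Finset.mem_univ _⟩)
  · refine Finset.mem_union_right _ (Finset.mem_image.2 ⟨(e.1 + Pi.single e.2 1, e.2),
      Finset.mem_product.2 ⟨h, Finset.mem_univ _⟩, ?_⟩)
    simp

/-- **Truncation of a gauge transformation to a finite link set.** For every `g : ℤ^d → G` and every finite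
link set `s` there is a finitely supported `g'` (trivial at both endpoints of every link outside a finite
link set `Λ`) whose gauge transformation agrees with that of `g` on the links of `s`: take `g' = g` on the
endpoints of `s` and `g' = 1` elsewhere. -/
theorem exists_gauge_truncation (g : Site d → G) (s : Finset (ZdEdge d)) :
    ∃ (g' : Site d → G) (Λ : Finset (ZdEdge d)),
      (∀ e ∉ Λ, g' e.1 = 1 ∧ g' (e.1 + Pi.single e.2 1) = 1) ∧
      ∀ (U : LGConfig d G) (e : ZdEdge d), e ∈ s → gaugeTransformZd g' U e = gaugeTransformZd g U e := by
  classical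
  let B : Finset (Site d) := s.image Prod.fst ∪ s.image fun e => e.1 + Pi.single e.2 1
  obtain ⟨Λ, hΛ⟩ := exists_finset_links_touching B
  refine ⟨fun x => if x ∈ B then g x else 1, Λ, fun e he => ?_, fun U e he => ?_⟩
  · have h1 : e.1 ∉ B := fun h => he (hΛ e (Or.inl h))
    have h2 : e.1 + Pi.single e.2 1 ∉ B := fun h => he (hΛ e (Or.inr h))
    simp [h1, h2]
  · have h1 : e.1 ∈ B := Finset.mem_union_left _ (Finset.mem_image_of_mem _ he)
    have h2 : e.1 + Pi.single e.2 1 ∈ B :=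
      Finset.mem_union_right _ (Finset.mem_image_of_mem (fun e : ZdEdge d => e.1 + Pi.single e.2 1) he)
    simp [gaugeTransformZd, h1, h2]

end GaugeGeometry

section Kernels

variable {d N : ℕ} {G : Type*} [Group G] [TopologicalSpace G] [IsTopologicalGroup G] [CompactSpace G]
  [MeasurableSpace G] [BorelSpace G] (ρ : G →* Matrix (Fin N) (Fin N) ℂ)

/-- **The Wilson kernel `γ_Λ(· | η)` depends on the exterior datum only off `Λ`**: if `η = η'` outside `Λ`
then `ymSpecification ρ β Λ η = ymSpecification ρ β Λ η'` (the glued configurations `ζ η_{Λᶜ}` and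
`ζ η'_{Λᶜ}` coincide for every `ζ : Λ → G`). -/
theorem ymSpecification_congr_exterior (β : ℝ) (Λ : Finset (ZdEdge d)) {η η' : LGConfig d G}
    (h : ∀ e ∉ Λ, η e = η' e) : ymSpecification ρ β Λ η = ymSpecification ρ β Λ η' := by
  have hglue : (fun ζ : ↥Λ → G => glueWith Λ ζ η) = fun ζ => glueWith Λ ζ η' := by
    funext ζ e
    by_cases he : e ∈ Λ
    · rw [glueWith_apply_mem Λ ζ η he, glueWith_apply_mem Λ ζ η' he]
    · rw [glueWith_apply_not_mem Λ ζ η he, glueWith_apply_not_mem Λ ζ η' he, h e he]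
  simp only [ymSpecification]
  rw [hglue]

variable [SecondCountableTopology G]

/-- **Gauge invariance of DLR states under finitely supported gauge transformations.** If `g` is trivial at
both endpoints of every link outside the finite link set `Λ`, then every DLR state `μ` of
`ymSpecification ρ β` satisfies `μ ∘ T_g⁻¹ = μ`: for measurable `A`,
`μ(T_g⁻¹ A) = ∫ γ_Λ(T_g⁻¹ A | η) dμ = ∫ γ_Λ(A | η^g) dμ = ∫ γ_Λ(A | η) dμ = μ(A)` by the DLR equation, gauge
covariance of the kernels (`ymSpecification_map_gaugeTransformZd_holds`) and `η^g = η` off `Λ`. -/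
theorem map_gaugeTransformZd_eq_of_eq_one_off (hρ : Continuous ρ) (β : ℝ) {μ : Measure (LGConfig d G)}
    (hμ : IsGibbsMeasure (ymSpecification ρ β) μ) {g : Site d → G} (Λ : Finset (ZdEdge d))
    (hg : ∀ e ∉ Λ, g e.1 = 1 ∧ g (e.1 + Pi.single e.2 1) = 1) :
    μ.map (gaugeTransformZd g) = μ := by
  have hT : Measurable (gaugeTransformZd (G := G) g) := measurable_gaugeTransformZd g
  ext A hA
  rw [Measure.map_apply hT hA, ← hμ.2 Λ (gaugeTransformZd g ⁻¹' A) (hT hA), ← hμ.2 Λ A hA]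
  refine lintegral_congr fun η => ?_
  rw [← Measure.map_apply hT hA, ymSpecification_map_gaugeTransformZd_holds ρ hρ β Λ η g,
    ymSpecification_congr_exterior ρ β Λ fun e he =>
      gaugeTransformZd_apply_of_eq_one η (hg e he).1 (hg e he).2]

/-- **Elitzur's theorem in DLR form (all `d`).** Every DLR state of the lattice Yang–Mills specification
`ymSpecification ρ β` is invariant under every gauge transformation `g : ℤ^d → G`: the two probability
measures `μ ∘ T_g⁻¹` and `μ` agree on the generating π-system of measurable cylinder sets, since on a
cylinder set over the finite link set `s` the transformation `T_g` acts as `T_{g'}` for the finitely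
supported truncation `g'` of `g` to the endpoints of `s` (`exists_gauge_truncation`), to which
`map_gaugeTransformZd_eq_of_eq_one_off` applies. -/
theorem map_gaugeTransformZd_eq_of_isGibbsMeasure (hρ : Continuous ρ) (β : ℝ) {μ : Measure (LGConfig d G)}
    (hμ : IsGibbsMeasure (ymSpecification ρ β) μ) (g : Site d → G) :
    μ.map (gaugeTransformZd g) = μ := by
  haveI := hμ.isProbabilityMeasure
  have hT : Measurable (gaugeTransformZd (G := G) g) := measurable_gaugeTransformZd g
  haveI : IsProbabilityMeasure (μ.map (gaugeTransformZd g)) :=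
    Measure.isProbabilityMeasure_map hT.aemeasurable
  refine ext_of_generate_finite (measurableCylinders fun _ : ZdEdge d => G)
    (generateFrom_measurableCylinders (α := fun _ : ZdEdge d => G)).symm isPiSystem_measurableCylinders
    (fun A hA => ?_) (by rw [measure_univ, measure_univ])
  obtain ⟨s, S, hS, rfl⟩ := (mem_measurableCylinders A).1 hA
  obtain ⟨g', Λ, hg', hagree⟩ := exists_gauge_truncation g s
  have hpre : gaugeTransformZd g ⁻¹' cylinder s S = gaugeTransformZd g' ⁻¹' cylinder s S := by
    ext U
    have h : s.restrict (gaugeTransformZd g U) = s.restrict (gaugeTransformZd g' U) :=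
      funext fun e => (hagree U e e.2).symm
    simp only [Set.mem_preimage, mem_cylinder, h]
  rw [Measure.map_apply hT (hS.cylinder s), hpre,
    ← Measure.map_apply (measurable_gaugeTransformZd g') (hS.cylinder s),
    map_gaugeTransformZd_eq_of_eq_one_off ρ hρ β hμ Λ hg']

end Kernels

/-- **DLR states are gauge invariant — Elitzur's theorem in DLR form** (registered stub `stub_dlr_gaugeInvariant`
(EZ1) of the skeleton `Cruxes/NonSimplyConnectedLatticeGap/Lines/Sketch.lean` v7 of item stmt-QuantumFields-16405):
for a compact second-countable Hausdorff gauge group `G`, a continuous representation `ρ` and any real `β`,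
every infinite-volume lattice Yang–Mills Gibbs state `μ ∈ 𝒢(β)` on `ℤ⁴` is invariant under all gauge
transformations, `μ ∘ (U ↦ U^g)⁻¹ = μ` (`map_gaugeTransformZd_eq_of_isGibbsMeasure` at `d = 4`). -/
theorem stub_dlr_gaugeInvariant : ∀ (G : Type) [Group G] [TopologicalSpace G] [IsTopologicalGroup G] [CompactSpace G] [MeasurableSpace G] [BorelSpace G] [SecondCountableTopology G] [T2Space G] (N : ℕ) (ρ : G →* Matrix (Fin N) (Fin N) ℂ), Continuous ρ → ∀ (β : ℝ) (μ : MeasureTheory.Measure (Literature.MathematicalPhysics.QuantumLattice.LGConfig 4 G)), μ ∈ Literature.MathematicalPhysics.QuantumLattice.ymGibbsMeasures ρ β → ∀ g : Literature.Probability.LatticeModels.Site 4 → G, μ.map (Literature.MathematicalPhysics.QuantumLattice.gaugeTransformZd g) = μ := by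
  intro G _ _ _ _ _ _ _ _ N ρ hρ β μ hμ g
  exact map_gaugeTransformZd_eq_of_isGibbsMeasure ρ hρ β
    ((Literature.MathematicalPhysics.QuantumLattice.mem_ymGibbsMeasures_iff ρ β μ).1 hμ) g

end Summit.QuantumFields.YangMills.Theorems.NonSimplyConnectedLatticeGap

end
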